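import Literature.MathematicalPhysics.QuantumFieldTheory.Balaban1983to89.B7Eq14LinearAverage
import Literature.MathematicalPhysics.QuantumFieldTheory.Balaban1983to89.B7Prop2Explicit
import Literature.MathematicalPhysics.QuantumFieldTheory.Balaban1983to89.B7BlockAvgLog

/-!
# T⁴ programme, spine estimate NE1′ (node O3b/H2) — THE ABELIAN SECTOR OF THE PRINTED AVERAGING (15) = (42)∕(43):
# on bond fields with pairwise commuting values Bałaban's block average IS `exp ∘ (L·(14))` EXACTLY — one-parameter
# configurations go to one-parameter configurations with a LINEAR amplitude map, at every level (no diagonal curvature)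

Cell `pub-balaban-gaps` (YM blitz Y1, track G2), seat `ne1` gen 8 (prover-pub-balaban-gaps-ne1-g8-0); record `HOME/ne/NE1.md` v8 §4 R49
and this generation's HANDOFF.  ADDITIVE — imports the b07 ∕ r04 lineages' `B7Eq14LinearAverage` (its `linAvg` (14),
`Tside_eq_smul_linAvg`, `Tside_csmul`; through it `B7Prop1Explicit` — `hol` (9), `asum`, `gammaWord` (14), `Wcx`∕`Xavg`∕`bavg` (42),
`Tside`∕`Xhat`∕`Xhat_eq` (47) — and `B7Prop3Flat.expCfg` (109)), `B7Prop2Explicit` (`avgIter`∕`rescale` (43)) and `B7BlockAvgLog`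
(`mlog_exp`: `log ∘ exp = id` on `‖·‖ < ln 2`) ONLY; every declaration consumed BY NAME, nothing edited or restated.  Sequel of gen 7's
`TiltedMeanOneParameter` ∕ `TiltedMeanOneParameterPrinted` (p358197 ✓ ∕ p363300 ✓), which proved «one-parameter slots are averaged
LINEARLY in the exponent, no `a²` term» for the CARRIERS `barAvg` ∕ (0.4) `eml` and left «the reduction of the full T-step (15) WITH ITS
CONTOUR SYSTEM to the carriers» a READING (NE1.md v7.4 R46 (a), door (f)).

PRINT.  [Balaban1985Averaging] = T. Bałaban, *Averaging operations for lattice gauge theories*, CMP **98** (1985) 17–51: (14) p. 19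
`Ā_c = Σ_{x∈B(c₋)} L^{−(d+1)}(A(Γ_{c₋,x}) + A([x, x(c)]) + A(Γ_{x(c),c₊}))`; (15) p. 19 `Ū_c = exp[i Σ_{x∈B(c₋)} L^{−d} (1/i) log
U(Γ_{c,x})U(c)⁻¹]U(c)`; p. 20 first sentence «It is easy to see that taking `U = e^{iA}` with `A` small and expanding the logarithm of
the expression on the right-hand side above in powers of `A`, we get the expression (14) as a linear term in the expansion.»; (42)∕(43)
pp. 23–24 (the same average on the `L`-bonds and its `k`-fold iterate).  The tree's `B7Eq14LinearAverage` (r04 gen 52) has that sentence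
as the DERIVATIVE AT `0` (`hasDerivAt_mlog_bavg_expCfg`: `d/dt|₀ log Ū_c(e^{tA}) = T_c = L·Ā_c`) for every bond field.

WHAT THIS FILE PROVES ([folklore] Banach-algebra bookkeeping over the b07 lineage's verbatim `ℤᵈ` model of (42)∕(43); 0 sorry).  Fix a
complete normed `ℂ`-algebra `𝔸` (`⊇ M_N(ℂ)`) and a bond field `A` on `ℤᵈ` whose values PAIRWISE COMMUTE (`hA`) — the abelian sectors
of the model: an abelian structure group, a maximal torus, or ONE ONE-PARAMETER SUBGROUP `A_b = s_b·C` (the slot model of NE1.md R46).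
* §1 sums `A(Γ)` of such a field commute with each other and with the field (`commute_asum_asum`).
* §2 **the parallel transport (9) is EXACTLY the exponential of the abelian path functional**: `e^{A}(Γ) = exp A(Γ)` for every word
  (`val_hol_expCfg`) — the abelian case of `B7Prop1Explicit.walk_linear` with NO remainder; hence the loop variable of (15)∕(42)
  `e^{A}(Γ_{c,x})e^{A}(c)⁻¹ = exp A(Γ_{c,x} ∪ (−c))` (`val_Wcx_expCfg`).
* §3 **(15) = `exp ∘ (L·(14))` in the abelian sector**: inside the printed logarithm radius (`‖A(Γ_{c,x} ∪ (−c))‖ < ln 2` for the `L^d`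
  loops of the bond) the exponent of (42) is its first-order term EXACTLY (`Xavg_expCfg : X_c(e^{A}) = X̂_c(A)`), and
  **`val_bavg_expCfg : Ū_c(e^{A}) = exp T_c(A) = exp(Σ_{x∈B(c₋)} L^{−d} A(Γ_{c,x}))`** = `exp(L·Ā_c)` (`val_bavg_expCfg_linAvg`) —
  p. 20's expansion has NO higher terms along commuting directions; as configurations `bavg L (e^{A}) = e^{T(A)}` (`bavg_expCfg`).
* §4 **closed under iteration (43)**: `T` preserves the abelian sector (`commute_Tside`), so `Ū^{j}(e^{A}) = e^{T^{j}(A)}` with the LINEAR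
  map `T^{j} = (rescale ∘ T)^{j}` at every level `j` at which the loops stay inside the logarithm radius (`avgIter_expCfg`).
* §5 **LINEARITY ∕ NO DIAGONAL CURVATURE**: along the ray `U = e^{tA}`, `Ū_c(e^{tA}) = exp(t·T_c(A))` (`val_bavg_expCfg_smul`), so
  `log Ū_c(e^{tA}) = t·T_c(A)` IS LINEAR on a neighbourhood of `t = 0` (`mlog_bavg_expCfg_smul`, `eventuallyEq_mlog_bavg_smul`) and
  its second derivative at `0` VANISHES (`iteratedDeriv_two_mlog_bavg_smul`) — against the general (non-commuting) case, where only
  the first derivative is `T_c` (r04) and the curvature is a sum of commutators (BCH (36)–(38), tree `B7Eq38Remainder`; centred at a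
  flat exterior by gen 7's `TiltedMeanSmoothDualSymmetry.integral_comm_eq_zero` modulo (α)).  One-parameter form: `val_bavg_oneParameter`
  (`A_b = s_b·C`, complex amplitudes `s`: `Ū_c = exp(T_c(s)·C)`, the amplitude of the image is the block-contour average `T_c(s)` of
  the amplitudes — LINEAR) and a sup-norm sufficient condition for the radius (`loops_small_of_norm_le`: `(2(d+1)L)·sup‖A_b‖ < ln 2`).
CONSEQUENCE FOR THE ROW (NE1.md v8 R49).  Door (f)'s one-parameter half is now kernel FOR THE PRINTED T-STEP (42)∕(43) WITH ITS CONTOUR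
SYSTEM, not only for the carriers: the diagonal curvature of Bałaban's averaging vanishes identically at all levels; what remains a
READING is the cross-bond (commutator) part and, as always, the instantiation on the RG densities (obligation (α)).  Classification
of NE1′ UNCHANGED: WORK-bound ∕ OBJECT-bound ∕ NOT idea-bound.

HONEST FRAMING.  [folklore] identities (`exp` of commuting elements, `log ∘ exp = id` on the printed radius, finite sums) over an
ABSTRACT complete normed `ℂ`-algebra and the b07 lineage's model of (42)∕(43) on `ℤᵈ` (corner blocks, tree contours); nothing of
Bałaban's is asserted beyond the SHAPE of (14)∕(15)∕(42)∕(43); no density, R-operation, slot or background of his run is constructed;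
NE1′ NOT proved; spine 0∕9; (B) 0∕13; binders 0∕6; one fixed finite T⁴ — NOT ℝ⁴, NOT infinite volume, NOT a mass gap, NOT Clay.
0 sorry.
-/

noncomputable section

open scoped BigOperators Topology
open NormedSpace Finset Filter

namespace Summit.QuantumFields.BalabanUV.T4Continuum.NE1p.B7AveragingAbelianSector

open Literature.MathematicalPhysics.QuantumFieldTheory.Balaban1983to89.B7Prop1Explicit
open Literature.MathematicalPhysics.QuantumFieldTheory.Balaban1983to89.B7Prop3Flat (expCfg asum_csmul)
open Literature.MathematicalPhysics.QuantumFieldTheory.Balaban1983to89.B7Prop2Explicit (avgIter rescale avgIter_succ)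
open Literature.MathematicalPhysics.QuantumFieldTheory.Balaban1983to89.B7Eq14LinearAverage (linAvg Tside_eq_smul_linAvg
  Tside_csmul)
open Literature.MathematicalPhysics.QuantumFieldTheory.Balaban1983to89.B7BlockAvgLog (mlog_exp)
open Literature.MathematicalPhysics.QuantumFieldTheory.Balaban1983to89.MatrixLog (mlog)
open Literature.Analysis.Complex (mem_eball_expSeries_radius)

variable {d : ℕ} {𝔸 : Type*} [NormedRing 𝔸] [NormedAlgebra ℂ 𝔸] [CompleteSpace 𝔸]
variable {A : Site d → Fin d → 𝔸}

/-! ## §1 Abelian sectors: bond fields with pairwise commuting values -/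

section Commuting

variable {A' : Site d → Fin d → 𝔸}

omit [NormedAlgebra ℂ 𝔸] [CompleteSpace 𝔸] in
/-- If the values of `A` commute with those of `A′`, every letter contribution `±A_b` commutes with `A′` (for `A′ = A`: an
abelian sector). [folklore] -/
theorem commute_stepA (hA : ∀ x κ y μ, Commute (A x κ) (A' y μ)) (x : Site d) (l : Letter d) (y : Site d) (μ : Fin d) :
    Commute (stepA A x l) (A' y μ) := by
  obtain ⟨ν, b⟩ := l
  cases b
  · rw [stepA_false]; exact (hA _ _ _ _).neg_left
  · rw [stepA_true]; exact hA _ _ _ _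

omit [NormedAlgebra ℂ 𝔸] [CompleteSpace 𝔸] in
/-- … and so does every path sum `A(Γ)`. [folklore] -/
theorem commute_asum_apply (hA : ∀ x κ y μ, Commute (A x κ) (A' y μ)) :
    ∀ (w : List (Letter d)) (x y : Site d) (μ : Fin d), Commute (asum A x w) (A' y μ)
  | [], x, y, μ => by rw [asum_nil]; exact Commute.zero_left _
  | l :: w, x, y, μ => by
    rw [asum_cons]; exact (commute_stepA hA x l y μ).add_left (commute_asum_apply hA w _ y μ)

omit [NormedAlgebra ℂ 𝔸] [CompleteSpace 𝔸] in
/-- … a letter contribution of `A` commutes with every path sum of `A′`. [folklore] -/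
theorem commute_stepA_asum (hA : ∀ x κ y μ, Commute (A x κ) (A' y μ)) (x : Site d) (l : Letter d) (x' : Site d)
    (w' : List (Letter d)) : Commute (stepA A x l) (asum A' x' w') := by
  have h' : ∀ x κ y μ, Commute (A' x κ) (A y μ) := fun x κ y μ => (hA y μ x κ).symm
  obtain ⟨ν, b⟩ := l
  cases b
  · rw [stepA_false]; exact (commute_asum_apply h' w' x' _ _).symm.neg_left
  · rw [stepA_true]; exact (commute_asum_apply h' w' x' _ _).symm

omit [NormedAlgebra ℂ 𝔸] [CompleteSpace 𝔸] in
/-- **Path sums of two bond fields with mutually commuting values commute** — for `A′ = A`: in an abelian sector the path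
sums `A(Γ)`, `A(Γ′)` commute. [folklore] -/
theorem commute_asum_asum (hA : ∀ x κ y μ, Commute (A x κ) (A' y μ)) :
    ∀ (w : List (Letter d)) (x x' : Site d) (w' : List (Letter d)), Commute (asum A x w) (asum A' x' w')
  | [], x, x', w' => by rw [asum_nil]; exact Commute.zero_left _
  | l :: w, x, x', w' => by
    rw [asum_cons]; exact (commute_stepA_asum hA x l x' w').add_left (commute_asum_asum hA w _ x' w')

end Commuting

/-! ## §2 The parallel transport (9) of `e^{A}` in an abelian sector is `exp A(Γ)` — exactly -/

section Transport

/-- One letter: `e^{A}(±b) = exp(±A_b)`. [cite: Balaban1985Averaging, (9) p.18, (109) p.34] -/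
theorem val_stepHol_expCfg (A : Site d → Fin d → 𝔸) (x : Site d) (l : Letter d) :
    ((stepHol (expCfg A) x l : 𝔸ˣ) : 𝔸) = exp (stepA A x l) := by
  obtain ⟨μ, b⟩ := l
  cases b
  · rw [stepHol_false, stepA_false]
    exact units_val_inv_eq_exp_neg rfl
  · rw [stepHol_true, stepA_true]; rfl

/-- **`e^{A}(Γ) = exp A(Γ)` for every word, when the values of `A` pairwise commute** — (9) with commuting factors multiplies
additively in the exponent; the abelian case of `B7Prop1Explicit.walk_linear`, with no remainder. [cite: Balaban1985Averaging, (9) p.18, p.25 (displays before (47))] -/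
theorem val_hol_expCfg (hA : ∀ x κ y μ, Commute (A x κ) (A y μ)) :
    ∀ (w : List (Letter d)) (x : Site d), ((hol (expCfg A) x w : 𝔸ˣ) : 𝔸) = exp (asum A x w)
  | [], x => by simp
  | l :: w, x => by
    rw [hol_cons, Units.val_mul, val_stepHol_expCfg, val_hol_expCfg hA w, asum_cons,
      exp_add_of_commute_of_mem_ball (commute_stepA_asum hA x l _ w) (mem_eball_expSeries_radius _)
        (mem_eball_expSeries_radius _)]

/-- **The loop variable of (15)∕(42) in an abelian sector**: `e^{A}(Γ_{c,x}) e^{A}(c)⁻¹ = exp A(Γ_{c,x} ∪ (−c))`. [cite: Balaban1985Averaging, (15) p.19, (42) p.23] -/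
theorem val_Wcx_expCfg (hA : ∀ x κ y μ, Commute (A x κ) (A y μ)) (L : ℕ) (q : Site d) (κ : Fin d) (r : Site d) :
    ((Wcx L (expCfg A) q κ r : 𝔸ˣ) : 𝔸) = exp (asum A q (gammaWord L κ r ++ seg κ (-(L : ℤ)))) := by
  rw [Wcx_eq_hol_loop, val_hol_expCfg hA]

/-- Inside the printed logarithm radius the logarithm of the loop variable IS the loop sum: `log[e^{A}(Γ_{c,x})e^{A}(c)⁻¹] =
A(Γ_{c,x} ∪ (−c))` («expanding the logarithm … (14) as a linear term» — here with no higher terms). [cite: Balaban1985Averaging, p.20 (sentence after (15)), (21) p.21] -/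
theorem mlog_Wcx_expCfg (hA : ∀ x κ y μ, Commute (A x κ) (A y μ)) (L : ℕ) (q : Site d) (κ : Fin d) (r : Site d)
    (h : ‖asum A q (gammaWord L κ r ++ seg κ (-(L : ℤ)))‖ < Real.log 2) :
    mlog ((Wcx L (expCfg A) q κ r : 𝔸ˣ) : 𝔸) = asum A q (gammaWord L κ r ++ seg κ (-(L : ℤ))) := by
  rw [val_Wcx_expCfg hA, mlog_exp h]

end Transport

/-! ## §3 (15) = `exp ∘ (L·(14))` in an abelian sector -/

section Average

variable {L : ℕ}

/-- **The exponent of (42) is its first-order term, exactly**: `X_c(e^{A}) = X̂_c(A) = Σ_x L^{−d} A(Γ_{c,x} ∪ (−c))` when the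
`L^d` loop sums of the bond lie inside the logarithm radius. [cite: Balaban1985Averaging, (42) p.23, p.25 (displays before (47))] -/
theorem Xavg_expCfg (hA : ∀ x κ y μ, Commute (A x κ) (A y μ)) (q : Site d) (κ : Fin d)
    (h : ∀ r : Fin d → Fin L, ‖asum A q (gammaWord L κ (boxVec L r) ++ seg κ (-(L : ℤ)))‖ < Real.log 2) :
    Xavg L (expCfg A) q κ = Xhat L A q κ := by
  unfold Xavg Xhat
  exact Finset.sum_congr rfl fun r _ => by rw [mlog_Wcx_expCfg hA L q κ _ (h r)]

omit [CompleteSpace 𝔸] in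
/-- The first-order exponent commutes with every path sum (abelian sector). [folklore] -/
theorem commute_Xhat_asum (hA : ∀ x κ y μ, Commute (A x κ) (A y μ)) (L : ℕ) (q : Site d) (κ : Fin d) (x : Site d)
    (w : List (Letter d)) : Commute (Xhat L A q κ) (asum A x w) := by
  unfold Xhat
  exact Commute.sum_left _ _ _ fun r _ => (commute_asum_asum hA _ _ _ _).smul_left _

/-- **(15) = `exp ∘ T` IN AN ABELIAN SECTOR, bond by bond**: for a bond field with pairwise commuting values whose loop sums at
the `L`-bond `c = ⟨q, q + Le_κ⟩` lie inside the logarithm radius, `Ū_c(e^{A}) = exp T_c(A) = exp(Σ_{x∈B(c₋)} L^{−d} A(Γ_{c,x}))`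
— p. 20's expansion «(14) as a linear term» has NO higher terms along commuting directions. [cite: Balaban1985Averaging, (15) p.19, p.20 (sentence after (15)), (42) p.23, (47) p.25] -/
theorem val_bavg_expCfg (hA : ∀ x κ y μ, Commute (A x κ) (A y μ)) (hL : 1 ≤ L) (q : Site d) (κ : Fin d)
    (h : ∀ r : Fin d → Fin L, ‖asum A q (gammaWord L κ (boxVec L r) ++ seg κ (-(L : ℤ)))‖ < Real.log 2) :
    ((bavg L (expCfg A) q κ : 𝔸ˣ) : 𝔸) = exp (Tside L A q κ) := by
  show (((expUnit (Xavg L (expCfg A) q κ) * hol (expCfg A) q (seg κ L) : 𝔸ˣ)) : 𝔸) = _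
  rw [Units.val_mul, val_expUnit, val_hol_expCfg hA, Xavg_expCfg hA q κ h,
    ← exp_add_of_commute_of_mem_ball (commute_Xhat_asum hA L q κ _ _) (mem_eball_expSeries_radius _)
      (mem_eball_expSeries_radius _), Xhat_eq L hL, sub_add_cancel]

/-- The same with print's (14): `Ū_c(e^{A}) = exp(L·Ā_c)`. [cite: Balaban1985Averaging, (14)–(15) p.19] -/
theorem val_bavg_expCfg_linAvg (hA : ∀ x κ y μ, Commute (A x κ) (A y μ)) (hL : 1 ≤ L) (q : Site d) (κ : Fin d)
    (h : ∀ r : Fin d → Fin L, ‖asum A q (gammaWord L κ (boxVec L r) ++ seg κ (-(L : ℤ)))‖ < Real.log 2) :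
    ((bavg L (expCfg A) q κ : 𝔸ˣ) : 𝔸) = exp ((L : ℝ) • linAvg L A q κ) := by
  rw [val_bavg_expCfg hA hL q κ h, Tside_eq_smul_linAvg L hL]

/-- **(42) MAPS THE ABELIAN CONFIGURATION `e^{A}` TO THE ABELIAN CONFIGURATION `e^{T(A)}`** (all `L`-bonds inside the radius).
[cite: Balaban1985Averaging, (42) p.23] -/
theorem bavg_expCfg (hA : ∀ x κ y μ, Commute (A x κ) (A y μ)) (hL : 1 ≤ L)
    (h : ∀ (q : Site d) (κ : Fin d) (r : Fin d → Fin L),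
      ‖asum A q (gammaWord L κ (boxVec L r) ++ seg κ (-(L : ℤ)))‖ < Real.log 2) :
    bavg L (expCfg A) = expCfg (Tside L A) := by
  funext q κ
  exact Units.ext (val_bavg_expCfg hA hL q κ (h q κ))

end Average

/-! ## §4 The abelian sector is preserved; the iterate (43) -/

section Iterate

variable {L : ℕ}

omit [CompleteSpace 𝔸] in
/-- `T` preserves the abelian sector: the first-order terms `T_c(A)`, `T_{c′}(A)` commute. [folklore] -/
theorem commute_Tside (hA : ∀ x κ y μ, Commute (A x κ) (A y μ)) (L : ℕ) (q : Site d) (κ : Fin d) (q' : Site d)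
    (κ' : Fin d) : Commute (Tside L A q κ) (Tside L A q' κ') := by
  unfold Tside
  exact Commute.sum_left _ _ _ fun r _ => Commute.sum_right _ _ _ fun r' _ =>
    ((commute_asum_asum hA _ _ _ _).smul_left _).smul_right _

/-- Rescaling (43) commutes with exponentiation: `rescale (e^{B}) = e^{rescale B}`. [cite: Balaban1985Averaging, (43) p.24] -/
theorem rescale_expCfg (L : ℕ) (B : Site d → Fin d → 𝔸) : rescale L (expCfg B) = expCfg (rescale L B) := rfl

omit [CompleteSpace 𝔸] in
/-- Every linear iterate `(rescale ∘ T)^{j}(A)` of an abelian field is abelian. [folklore] -/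
theorem commute_linIterate (hA : ∀ x κ y μ, Commute (A x κ) (A y μ)) (L : ℕ) :
    ∀ (j : ℕ) (x : Site d) (κ : Fin d) (y : Site d) (μ : Fin d),
      Commute (((fun B => rescale L (Tside L B))^[j] A) x κ) (((fun B => rescale L (Tside L B))^[j] A) y μ)
  | 0 => hA
  | j + 1 => by
    intro x κ y μ
    rw [Function.iterate_succ_apply']
    exact commute_Tside (commute_linIterate hA L j) L _ _ _ _

/-- **THE ITERATE (43) IN AN ABELIAN SECTOR**: `Ū^{j}(e^{A}) = e^{(rescale ∘ T)^{j}(A)}` — a LINEAR function of `A` exponentiated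
— at every level `j` below which all loop sums stay inside the logarithm radius. [cite: Balaban1985Averaging, (43) p.24] -/
theorem avgIter_expCfg (hA : ∀ x κ y μ, Commute (A x κ) (A y μ)) (hL : 1 ≤ L) (j : ℕ)
    (h : ∀ i < j, ∀ (q : Site d) (κ : Fin d) (r : Fin d → Fin L),
      ‖asum (((fun B => rescale L (Tside L B))^[i] A)) q (gammaWord L κ (boxVec L r) ++ seg κ (-(L : ℤ)))‖ < Real.log 2) :
    avgIter L (expCfg A) j = expCfg (((fun B => rescale L (Tside L B))^[j] A)) := by
  induction j with
  | zero => rfl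
  | succ j ih =>
    rw [avgIter_succ, ih (fun i hi => h i (Nat.lt_succ_of_lt hi)),
      bavg_expCfg (commute_linIterate hA L j) hL (h j (Nat.lt_succ_self j)), rescale_expCfg,
      Function.iterate_succ_apply']

end Iterate

/-! ## §5 Linearity along the ray `U = e^{tA}`: no diagonal curvature -/

section Ray

variable {L : ℕ}

omit [CompleteSpace 𝔸] in
/-- A scalar multiple of an abelian field is abelian. [folklore] -/
theorem commute_smul (hA : ∀ x κ y μ, Commute (A x κ) (A y μ)) (t : ℂ) :
    ∀ x κ y μ, Commute ((t • A) x κ) ((t • A) y μ) :=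
  fun x κ y μ => ((hA x κ y μ).smul_left t).smul_right t

/-- **`Ū_c(e^{tA}) = exp(t·T_c(A))`** in an abelian sector: the image of the one-parameter family `t ↦ e^{tA}` is the one-parameter
family of `T_c(A)` — LINEAR in `t`, NO `t²` TERM. [cite: Balaban1985Averaging, (15) p.19, p.20 (sentence after (15))] -/
theorem val_bavg_expCfg_smul (hA : ∀ x κ y μ, Commute (A x κ) (A y μ)) (hL : 1 ≤ L) (t : ℂ) (q : Site d) (κ : Fin d)
    (h : ∀ r : Fin d → Fin L, ‖asum (t • A) q (gammaWord L κ (boxVec L r) ++ seg κ (-(L : ℤ)))‖ < Real.log 2) :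
    ((bavg L (expCfg (t • A)) q κ : 𝔸ˣ) : 𝔸) = exp (t • Tside L A q κ) := by
  rw [val_bavg_expCfg (commute_smul hA t) hL q κ h, Tside_csmul]

/-- **`log Ū_c(e^{tA}) = t·T_c(A)`** in an abelian sector (loops and image inside the logarithm radius). [cite: Balaban1985Averaging, p.20 (sentence after (15))] -/
theorem mlog_bavg_expCfg_smul (hA : ∀ x κ y μ, Commute (A x κ) (A y μ)) (hL : 1 ≤ L) (t : ℂ) (q : Site d) (κ : Fin d)
    (h : ∀ r : Fin d → Fin L, ‖asum (t • A) q (gammaWord L κ (boxVec L r) ++ seg κ (-(L : ℤ)))‖ < Real.log 2)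
    (h' : ‖t • Tside L A q κ‖ < Real.log 2) :
    mlog ((bavg L (expCfg (t • A)) q κ : 𝔸ˣ) : 𝔸) = t • Tside L A q κ := by
  rw [val_bavg_expCfg_smul hA hL t q κ h, mlog_exp h']

omit [CompleteSpace 𝔸] in
/-- For `t` near `0` all the (finitely many) loop sums of `tA` at one `L`-bond, and `t·T_c(A)`, lie inside the logarithm radius.
[folklore] -/
theorem eventually_loops_small (A : Site d → Fin d → 𝔸) (L : ℕ) (q : Site d) (κ : Fin d) :
    ∀ᶠ t : ℂ in 𝓝 0, (∀ r : Fin d → Fin L,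
        ‖asum (t • A) q (gammaWord L κ (boxVec L r) ++ seg κ (-(L : ℤ)))‖ < Real.log 2) ∧
      ‖t • Tside L A q κ‖ < Real.log 2 := by
  have h2 : (0 : ℝ) < Real.log 2 := Real.log_pos one_lt_two
  have key : ∀ X : 𝔸, ∀ᶠ t : ℂ in 𝓝 0, ‖t • X‖ < Real.log 2 := fun X => by
    have hc : Continuous fun t : ℂ => ‖t • X‖ := (continuous_id.smul continuous_const).norm
    exact (isOpen_lt hc continuous_const).mem_nhds (by simpa using h2)
  refine (Filter.eventually_all.2 fun r => ?_).and (key _)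
  simpa only [asum_csmul] using key (asum A q (gammaWord L κ (boxVec L r) ++ seg κ (-(L : ℤ))))

/-- **`log Ū_c(e^{tA})` IS THE LINEAR FUNCTION `t·T_c(A)` ON A NEIGHBOURHOOD OF `0`** (abelian sector). [cite: Balaban1985Averaging, p.20 (sentence after (15))] -/
theorem eventuallyEq_mlog_bavg_smul (hA : ∀ x κ y μ, Commute (A x κ) (A y μ)) (hL : 1 ≤ L) (q : Site d) (κ : Fin d) :
    (fun t : ℂ => mlog ((bavg L (expCfg (t • A)) q κ : 𝔸ˣ) : 𝔸)) =ᶠ[𝓝 0] fun t => t • Tside L A q κ :=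
  (eventually_loops_small A L q κ).mono fun t ht => mlog_bavg_expCfg_smul hA hL t q κ ht.1 ht.2

/-- **NO DIAGONAL CURVATURE**: in an abelian sector the second derivative of `t ↦ log Ū_c(e^{tA})` at `0` vanishes (the first being
`T_c(A)` for EVERY field, `B7Eq14LinearAverage.hasDerivAt_mlog_bavg_expCfg`). [cite: Balaban1985Averaging, p.20 (sentence after (15))] -/
theorem iteratedDeriv_two_mlog_bavg_smul (hA : ∀ x κ y μ, Commute (A x κ) (A y μ)) (hL : 1 ≤ L) (q : Site d)
    (κ : Fin d) : iteratedDeriv 2 (fun t : ℂ => mlog ((bavg L (expCfg (t • A)) q κ : 𝔸ˣ) : 𝔸)) 0 = 0 := by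
  rw [(eventuallyEq_mlog_bavg_smul hA hL q κ).iteratedDeriv_eq]
  have h1 : deriv (fun t : ℂ => t • Tside L A q κ) = fun _ => Tside L A q κ := by
    funext t
    simpa using deriv_smul_const (f := Tside L A q κ) differentiableAt_id (x := t)
  rw [iteratedDeriv_succ, iteratedDeriv_one, h1, deriv_const]

end Ray

/-! ## §6 One one-parameter subgroup; a sup-norm sufficient condition for the radius -/

section OneParameter

variable {L : ℕ}

omit [CompleteSpace 𝔸] in
/-- Path sums of the field `(s_b·C)_b` are `(path sum of the amplitudes)·C`. [folklore] -/
theorem asum_smul_const (s : Site d → Fin d → ℂ) (C : 𝔸) :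
    ∀ (w : List (Letter d)) (x : Site d), asum (fun y μ => s y μ • C) x w = asum s x w • C
  | [], x => by simp
  | l :: w, x => by
    rw [asum_cons, asum_cons, asum_smul_const s C w, add_smul]
    congr 1
    obtain ⟨μ, b⟩ := l
    cases b
    · rw [stepA_false, stepA_false, neg_smul]
    · rw [stepA_true, stepA_true]

omit [CompleteSpace 𝔸] in
/-- The first-order term of the field `(s_b·C)_b` is `T_c(s)·C` — the block-contour average (47) of the amplitudes. [cite: Balaban1985Averaging, (47) p.25] -/
theorem Tside_smul_const (s : Site d → Fin d → ℂ) (C : 𝔸) (q : Site d) (κ : Fin d) :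
    Tside L (fun y μ => s y μ • C) q κ = Tside L s q κ • C := by
  simp only [Tside, asum_smul_const]
  rw [Finset.sum_smul]
  exact Finset.sum_congr rfl fun r _ => (smul_assoc _ _ _).symm

/-- **ONE-PARAMETER CONFIGURATIONS ARE AVERAGED INSIDE THEIR SUBGROUP, LINEARLY IN THE AMPLITUDES**: for `U_b = exp(s_b·C)` with
the loop amplitude sums inside the radius, `Ū_c = exp(T_c(s)·C)` — the printed T-step (42) with its contour system maps the
one-parameter subgroup of `C` to itself, the new amplitude being the LINEAR block-contour average `T_c(s)` of the old ones. [cite: Balaban1985Averaging, (15) p.19, (42) p.23, (47) p.25] -/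
theorem val_bavg_oneParameter (hL : 1 ≤ L) (s : Site d → Fin d → ℂ) (C : 𝔸) (q : Site d) (κ : Fin d)
    (h : ∀ r : Fin d → Fin L, ‖asum s q (gammaWord L κ (boxVec L r) ++ seg κ (-(L : ℤ))) • C‖ < Real.log 2) :
    ((bavg L (expCfg fun y μ => s y μ • C) q κ : 𝔸ˣ) : 𝔸) = exp (Tside L s q κ • C) := by
  have hA : ∀ x κ y μ, Commute ((fun y μ => s y μ • C) x κ) ((fun y μ => s y μ • C) y μ) :=
    fun x κ y μ => ((Commute.refl C).smul_left _).smul_right _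
  rw [val_bavg_expCfg hA hL q κ (fun r => by simpa only [asum_smul_const] using h r), Tside_smul_const]

/-- **NO `a²` TERM FOR THE PRINTED T-STEP**: scaling the amplitudes by `a` scales the image amplitude by `a`. [cite: Balaban1985Averaging, (15) p.19, (42) p.23] -/
theorem val_bavg_oneParameter_scale (hL : 1 ≤ L) (s : Site d → Fin d → ℂ) (C : 𝔸) (a : ℂ) (q : Site d) (κ : Fin d)
    (h : ∀ r : Fin d → Fin L, ‖asum (a • s) q (gammaWord L κ (boxVec L r) ++ seg κ (-(L : ℤ))) • C‖ < Real.log 2) :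
    ((bavg L (expCfg fun y μ => (a * s y μ) • C) q κ : 𝔸ˣ) : 𝔸) = exp ((a * Tside L s q κ) • C) := by
  have := val_bavg_oneParameter hL (a • s) C q κ h
  simpa only [Pi.smul_apply, smul_eq_mul, Tside_csmul] using this

omit [NormedAlgebra ℂ 𝔸] [CompleteSpace 𝔸] in
/-- Radius bookkeeping: a sup bound `‖A_b‖ ≤ a` with `2(d+1)L·a < ln 2` puts every loop sum `A(Γ_{c,x} ∪ (−c))` (a word of length
`2|x − c₋|₁ + 2L ≤ 2(d+1)L`) inside the logarithm radius. [cite: Balaban1985Averaging, (14) p.19, (22)–(23) p.21] -/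
theorem loops_small_of_norm_le {a : ℝ} (ha : 0 ≤ a) (hA : ∀ x κ, ‖A x κ‖ ≤ a)
    (hrad : (2 * ((d : ℝ) + 1) * L) * a < Real.log 2) (q : Site d) (κ : Fin d) (r : Fin d → Fin L) :
    ‖asum A q (gammaWord L κ (boxVec L r) ++ seg κ (-(L : ℤ)))‖ < Real.log 2 := by
  set w := gammaWord L κ (boxVec L r) ++ seg κ (-(L : ℤ)) with hw
  have hlen : (w.length : ℝ) ≤ 2 * ((d : ℝ) + 1) * L := by
    have h1 : w.length = 2 * l1 (boxVec L r) + L + L := by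
      rw [hw, List.length_append, length_gammaWord, length_seg, Int.natAbs_neg, Int.natAbs_natCast]
    have h2 := l1_boxVec_le L r
    have h3 : (w.length : ℝ) = 2 * (l1 (boxVec L r) : ℝ) + L + L := by rw [h1]; push_cast; ring
    have h4 : (l1 (boxVec L r) : ℝ) ≤ (d : ℝ) * L := by exact_mod_cast h2
    rw [h3]; nlinarith
  have hb := norm_asum_le A q w.length ha (fun x κ _ => hA x κ) w q (by simp [l1])
  calc ‖asum A q w‖ ≤ (w.length : ℝ) * a := hb
    _ ≤ (2 * ((d : ℝ) + 1) * L) * a := by gcongr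
    _ < Real.log 2 := hrad

end OneParameter

end Summit.QuantumFields.BalabanUV.T4Continuum.NE1p.B7AveragingAbelianSector

end
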